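import Mathlib
import Summits.NavierStokesRegularity.FluidComputer.AbcClassIICertificateCoords
import Summits.NavierStokesRegularity.FluidComputer.AbcInertiaBases
import Summits.NavierStokesRegularity.FluidComputer.AbcInertiaDictionary
import Summits.NavierStokesRegularity.FluidComputer.AbcInertiaRows
import Summits.NavierStokesRegularity.FluidComputer.AbcClassIIX0RowsLow

/-!
# «EXACTLY ONE»: the X0 bracket and the INERTIA-3L count together — at `R = 300` the linearisation about the
# forced ABC flow has EXACTLY ONE classical class-II eigenvalue with `Re z ≥ 1/5`, and it is real, in
# `[0.2517, 0.2717]` (instab3 g8, cell `ns-blowup`, 2026-08-27)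

HONEST FRAMING (human rulings D-0035/D-0074): **MODEL linear operator, computer-assisted; not NS.** Nothing
here is a statement about Navier–Stokes regularity or blow-up. Object: the linearisation of forced NS about
`U = abcFlow 1 1 1` on the unit torus at viscosity `1/(2π·300)` (= `R = 300` in certifier units), symmetry
class II. bears_on LADDER-NS N1* T6 / profile W3: «λ*_II(300) is THE class-II leader: rightmost, simple».

**`R300II_exactly_one`** (implementation 2's cells; in ANY family `e` of real orthonormal orbit bases, so the
certifiers' own bases qualify modulo AUDIT-BASIS): the two X0 facts of cert.py j249196
((T1) opposite head determinant signs on `cubeIdx 28` at `x₁ = 0.2517`, `x₂ = 0.2717`; (T2) shell Schur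
forms ≥ `mu2lb` — `SkewCutBracketReproductions.X0R300`, as in `AbcClassIIX0RowsLow.X0R300_isLinNSEigenvalue_Ioo`)
AND the two INERTIA-3L facts of inertia_cert j269943 ((R1) `𝓜 ≺ 0` on `H = {|O|² ≤ 29²}`, (R2) `GH + VVᵀ ≽ 0`,
cell `(300, II, 1/5, 1; 28, 29)`, as in `AbcInertiaRows.R300II_rL28_rH29_card_le_one`) IMPLY:
there is a REAL `λ⋆ ∈ [x₁, x₂]` and a classical eigenpair `(λ⋆, u⋆)` (`Torus.LinNSResolventRel … (2πλ⋆) u⋆ 0`,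
`u⋆ ≠ 0`) with CLASS-II Fourier coefficients, and EVERY classical eigenpair `(z, u)` with class-II Fourier
coefficients and `Re z ≥ 1/5` has `z = λ⋆`. I.e. `σ_p(L_300|II) ∩ {Re ≥ 1/5} = {λ⋆}` for classical
eigenfunctions (MODEL). Ingredients: `AbcClassIICertificateCoords.coordinates_of_certificate` (instab4's X0
chain with the coordinate eigenvector exported) + instab4's basis transfer (`head_sign_transfer`,
`shell_form_transfer`) ⇒ `coordinates_of_certificate_of_bases`; `AbcInertiaDictionary.classII_eigenfunction_of_
coordinates`; `AbcInertiaBases.card_classII_eigenfunctions_le_of_inertia_certificate_of_bases`;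
`AbcInertiaRows.eq_leader_of_card_le_one`. `R300II_exactly_one_i3` is the same sentence from IMPLEMENTATION 1's
cells (i3cert j249549 constants `K3`, `mu2lb*_3`; INERTIA cell `(28, 30)`, cert 42d246b366f59d1b, j269623) — the
two-engine rule at the level of kernel implications. What is NOT kernel: (T1)(T2)(R1)(R2) themselves = the programs'
verified arithmetic (referee re-runs: METHOD-I4 §8 DISCHARGED 5/5 rows for X0 (STATUS 2026-08-27 09:54Z);
INERTIA turnkeys TURNKEY-I3L / INERTIA-I4 §7), and AUDIT-BASIS for the chosen bases.

Mathlib + the files named; no new definitions; std axioms. [folklore]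
-/

noncomputable section

open scoped BigOperators ComplexConjugate InnerProductSpace Matrix
open Finset Matrix MeasureTheory UnitAddTorus

namespace Summit.NavierStokesRegularity.FluidComputer.AbcInertia

open Literature.Analysis.FunctionSpaces Literature.Analysis.FunctionSpaces.Torus
open Literature.Analysis.FunctionSpaces.EuclideanSpace
open Literature.Analysis.FluidPDE Literature.Analysis.FluidPDE.SteadyLattice
open Summit.NavierStokesRegularity.FluidComputer.AbcClassII

section ExactlyOne

variable (e : ∀ O : Orbit, OrthonormalBasis (Fin (odim O)) ℝ (realSpace O.1))
variable (bf : Idx → Fam)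
variable (hbf : ∀ i : Idx, bf i = extend i.1.1 ((e i.1 i.2 : realSpace i.1.1) : EuclideanSpace ℂ (↥i.1.1 × Fin 3)))
variable (am : Idx → Idx → ℝ)
variable (ham : ∀ i j : Idx, am i j =
  (∑ k ∈ i.1.1, (inner ℂ (bf i k) (Torus.lerayCoeff k (crossForm 1 1 1 (bf j) k)) : ℂ)).re)

include hbf ham in
/-- **(T1)(T2)(T3) in arbitrary orbit bases ⇒ a rapidly decaying coordinate eigenvector (basis `bfam`) with
eigenvalue in `[x₁, x₂]`** (instab4's `isLinNSEigenvalue_of_certificate_of_bases` with the coordinates exported). -/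
theorem coordinates_of_certificate_of_bases {R : ℝ} (hR : 1 ≤ R) (K : ℕ) {x₁ x₂ : ℝ} (hlt : x₁ < x₂)
    (μ₁ μ₂ : ℝ) (hμ₁ : 0 < μ₁) (hμ₂ : 0 < μ₂)
    (hq₁ : μ₁ ≤ x₁ + ((K : ℝ) + 2) ^ 2 / R - Real.sqrt 2) (hq₂ : μ₂ ≤ x₂ + ((K : ℝ) + 2) ^ 2 / R - Real.sqrt 2)
    (hdet : (Matrix.of fun a b : ↥(cubeIdx K) =>
        (if (a : Idx) = b then x₁ + onormSq (b : Idx).1 / R else 0) - am a b).det *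
      (Matrix.of fun a b : ↥(cubeIdx K) =>
        (if (a : Idx) = b then x₂ + onormSq (b : Idx).1 / R else 0) - am a b).det < 0)
    (hX₁ : ∀ w : ↥(cubeIdx (K + 1) \ cubeIdx K) → ℝ, μ₁ * (w ⬝ᵥ w) ≤
      ∑ a : ↥(cubeIdx (K + 1) \ cubeIdx K), (x₁ + onormSq (a : Idx).1 / R) * w a ^ 2 - Real.sqrt 2 * (w ⬝ᵥ w) -
        w ⬝ᵥ (((Matrix.of fun (a : ↥(cubeIdx (K + 1) \ cubeIdx K)) (b : ↥(cubeIdx K)) =>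
            (if (a : Idx) = b then x₁ + onormSq (b : Idx).1 / R else 0) - am a b) *
          (Matrix.of fun a b : ↥(cubeIdx K) =>
            (if (a : Idx) = b then x₁ + onormSq (b : Idx).1 / R else 0) - am a b)⁻¹ *
          (Matrix.of fun (a : ↥(cubeIdx K)) (b : ↥(cubeIdx (K + 1) \ cubeIdx K)) =>
            (if (a : Idx) = b then x₁ + onormSq (b : Idx).1 / R else 0) - am a b)) *ᵥ w))
    (hX₂ : ∀ w : ↥(cubeIdx (K + 1) \ cubeIdx K) → ℝ, μ₂ * (w ⬝ᵥ w) ≤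
      ∑ a : ↥(cubeIdx (K + 1) \ cubeIdx K), (x₂ + onormSq (a : Idx).1 / R) * w a ^ 2 - Real.sqrt 2 * (w ⬝ᵥ w) -
        w ⬝ᵥ (((Matrix.of fun (a : ↥(cubeIdx (K + 1) \ cubeIdx K)) (b : ↥(cubeIdx K)) =>
            (if (a : Idx) = b then x₂ + onormSq (b : Idx).1 / R else 0) - am a b) *
          (Matrix.of fun a b : ↥(cubeIdx K) =>
            (if (a : Idx) = b then x₂ + onormSq (b : Idx).1 / R else 0) - am a b)⁻¹ *
          (Matrix.of fun (a : ↥(cubeIdx K)) (b : ↥(cubeIdx (K + 1) \ cubeIdx K)) =>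
            (if (a : Idx) = b then x₂ + onormSq (b : Idx).1 / R else 0) - am a b)) *ᵥ w)) :
    ∃ lam ∈ Set.Icc x₁ x₂, ∃ wc : Idx → ℂ, wc ≠ 0 ∧
      (∀ s : ℕ, Summable fun i : Idx => (1 + onormSq i.1) ^ s * ‖wc i‖ ^ 2) ∧
      ∀ i : Idx, ((-(onormSq i.1 / R) : ℝ) : ℂ) * wc i + ∑ j ∈ nbrIdx i, ((amat i j : ℝ) : ℂ) * wc j =
        (lam : ℂ) * wc i :=
  coordinates_of_certificate hR K hlt μ₁ μ₂ hμ₁ hμ₂ hq₁ hq₂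
    (head_sign_transfer e bf hbf am ham R K x₁ x₂ hdet)
    (shell_form_transfer e bf hbf am ham R K x₁ μ₁ hX₁)
    (shell_form_transfer e bf hbf am ham R K x₂ μ₂ hX₂)

include hbf ham in
/-- **R = 300, CLASS II: EXACTLY ONE classical class-II eigenvalue with `Re z ≥ 1/5`** — the X0 row
(implementation 2: (T1)(T2) of cert.py j249196, `SkewCutBracketReproductions.X0R300`) and the INERTIA-3L cell
`(300, II, 1/5, 1; 28, 29)` (implementation 2: (R1)(R2) of inertia_cert j269943), both stated in the bases `e`,
imply: `∃ λ⋆ ∈ [x₁, x₂]` real with a classical CLASS-II eigenfunction, and every classical class-II eigenpair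
`(z, u)` with `Re z ≥ 1/5` has `z = λ⋆`. MODEL; conditional on the two certifier audits. -/
theorem R300II_exactly_one
    (hdet : (Matrix.of fun a b : ↥(cubeIdx SkewCutBracketReproductions.X0R300.K4) =>
        (if (a : Idx) = b then ((SkewCutBracketReproductions.X0R300.x1 : ℚ) : ℝ) + onormSq (b : Idx).1 / ((SkewCutBracketReproductions.X0R300.R : ℕ) : ℝ) else 0) - am a b).det *
      (Matrix.of fun a b : ↥(cubeIdx SkewCutBracketReproductions.X0R300.K4) =>
        (if (a : Idx) = b then ((SkewCutBracketReproductions.X0R300.x2 : ℚ) : ℝ) + onormSq (b : Idx).1 / ((SkewCutBracketReproductions.X0R300.R : ℕ) : ℝ) else 0) - am a b).det < 0)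
    (hX₁ : ∀ w : ↥(cubeIdx (SkewCutBracketReproductions.X0R300.K4 + 1) \ cubeIdx SkewCutBracketReproductions.X0R300.K4) → ℝ, ((SkewCutBracketReproductions.X0R300.mu2lb1_4 : ℚ) : ℝ) * (w ⬝ᵥ w) ≤
      ∑ a : ↥(cubeIdx (SkewCutBracketReproductions.X0R300.K4 + 1) \ cubeIdx SkewCutBracketReproductions.X0R300.K4), (((SkewCutBracketReproductions.X0R300.x1 : ℚ) : ℝ) + onormSq (a : Idx).1 / ((SkewCutBracketReproductions.X0R300.R : ℕ) : ℝ)) * w a ^ 2 -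
          Real.sqrt 2 * (w ⬝ᵥ w) -
        w ⬝ᵥ (((Matrix.of fun (a : ↥(cubeIdx (SkewCutBracketReproductions.X0R300.K4 + 1) \ cubeIdx SkewCutBracketReproductions.X0R300.K4)) (b : ↥(cubeIdx SkewCutBracketReproductions.X0R300.K4)) =>
            (if (a : Idx) = b then ((SkewCutBracketReproductions.X0R300.x1 : ℚ) : ℝ) + onormSq (b : Idx).1 / ((SkewCutBracketReproductions.X0R300.R : ℕ) : ℝ) else 0) - am a b) *
          (Matrix.of fun a b : ↥(cubeIdx SkewCutBracketReproductions.X0R300.K4) =>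
            (if (a : Idx) = b then ((SkewCutBracketReproductions.X0R300.x1 : ℚ) : ℝ) + onormSq (b : Idx).1 / ((SkewCutBracketReproductions.X0R300.R : ℕ) : ℝ) else 0) - am a b)⁻¹ *
          (Matrix.of fun (a : ↥(cubeIdx SkewCutBracketReproductions.X0R300.K4)) (b : ↥(cubeIdx (SkewCutBracketReproductions.X0R300.K4 + 1) \ cubeIdx SkewCutBracketReproductions.X0R300.K4)) =>
            (if (a : Idx) = b then ((SkewCutBracketReproductions.X0R300.x1 : ℚ) : ℝ) + onormSq (b : Idx).1 / ((SkewCutBracketReproductions.X0R300.R : ℕ) : ℝ) else 0) - am a b)) *ᵥ w))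
    (hX₂ : ∀ w : ↥(cubeIdx (SkewCutBracketReproductions.X0R300.K4 + 1) \ cubeIdx SkewCutBracketReproductions.X0R300.K4) → ℝ, ((SkewCutBracketReproductions.X0R300.mu2lb2_4 : ℚ) : ℝ) * (w ⬝ᵥ w) ≤
      ∑ a : ↥(cubeIdx (SkewCutBracketReproductions.X0R300.K4 + 1) \ cubeIdx SkewCutBracketReproductions.X0R300.K4), (((SkewCutBracketReproductions.X0R300.x2 : ℚ) : ℝ) + onormSq (a : Idx).1 / ((SkewCutBracketReproductions.X0R300.R : ℕ) : ℝ)) * w a ^ 2 -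
          Real.sqrt 2 * (w ⬝ᵥ w) -
        w ⬝ᵥ (((Matrix.of fun (a : ↥(cubeIdx (SkewCutBracketReproductions.X0R300.K4 + 1) \ cubeIdx SkewCutBracketReproductions.X0R300.K4)) (b : ↥(cubeIdx SkewCutBracketReproductions.X0R300.K4)) =>
            (if (a : Idx) = b then ((SkewCutBracketReproductions.X0R300.x2 : ℚ) : ℝ) + onormSq (b : Idx).1 / ((SkewCutBracketReproductions.X0R300.R : ℕ) : ℝ) else 0) - am a b) *
          (Matrix.of fun a b : ↥(cubeIdx SkewCutBracketReproductions.X0R300.K4) =>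
            (if (a : Idx) = b then ((SkewCutBracketReproductions.X0R300.x2 : ℚ) : ℝ) + onormSq (b : Idx).1 / ((SkewCutBracketReproductions.X0R300.R : ℕ) : ℝ) else 0) - am a b)⁻¹ *
          (Matrix.of fun (a : ↥(cubeIdx SkewCutBracketReproductions.X0R300.K4)) (b : ↥(cubeIdx (SkewCutBracketReproductions.X0R300.K4 + 1) \ cubeIdx SkewCutBracketReproductions.X0R300.K4)) =>
            (if (a : Idx) = b then ((SkewCutBracketReproductions.X0R300.x2 : ℚ) : ℝ) + onormSq (b : Idx).1 / ((SkewCutBracketReproductions.X0R300.R : ℕ) : ℝ) else 0) - am a b)) *ᵥ w))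
    {HL HH HB : Finset Idx}
    (hHL : ∀ i : Idx, i ∈ HL ↔ onormSq i.1 ≤ (28 : ℝ) ^ 2)
    (hHH : ∀ i : Idx, i ∈ HH ↔ onormSq i.1 ≤ (29 : ℝ) ^ 2)
    (hHB : ∀ i : Idx, i ∈ HB ↔ (29 : ℝ) ^ 2 < onormSq i.1 ∧ onormSq i.1 ≤ ((29 : ℝ) + 1) ^ 2)
    (GH' Ah' : Matrix ↥HH ↥HH ℝ) (AHB' : Matrix ↥HH ↥HB ℝ) (ABH' : Matrix ↥HB ↥HH ℝ) (E : ↥HB → ℝ)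
    (V' : Matrix ↥HH (Fin 1) ℝ) (hGH' : GH'ᵀ = GH')
    (hAh' : Ah' = Matrix.of fun i j : ↥HH =>
      (if i = j then -(onormSq i.1.1 / (300 : ℝ)) - (1 / 5 : ℝ) else 0) + am i.1 j.1)
    (hAHB' : AHB' = Matrix.of fun (i : ↥HH) (l : ↥HB) => am i.1 l.1)
    (hABH' : ABH' = Matrix.of fun (l : ↥HB) (i : ↥HH) => am l.1 i.1)
    (hE : E = fun l : ↥HB => onormSq l.1.1 / (300 : ℝ) + (1 / 5 : ℝ) - Real.sqrt 2)
    (hR1' : ∀ x : ↥HH → ℝ, x ≠ 0 →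
      x ⬝ᵥ ((GH' * Ah' + Ah'ᵀ * GH' + (1 / 2 : ℝ) • ((GH' * AHB' + ABH'ᵀ) * Matrix.diagonal (fun l => (E l)⁻¹) *
        (GH' * AHB' + ABH'ᵀ)ᵀ)) *ᵥ x) < 0)
    (hR2' : ∀ x : ↥HH → ℝ, 0 ≤ x ⬝ᵥ ((GH' + V' * V'ᵀ) *ᵥ x)) :
    ∃ lam : ℝ, lam ∈ Set.Icc ((SkewCutBracketReproductions.X0R300.x1 : ℚ) : ℝ) ((SkewCutBracketReproductions.X0R300.x2 : ℚ) : ℝ) ∧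
      (∃ u : UnitAddTorus (Fin 3) → EuclideanSpace ℂ (Fin 3),
        Torus.LinNSResolventRel (1 / (2 * Real.pi * (300 : ℝ))) (Torus.abcFlow 1 1 1) (2 * Real.pi * (lam : ℂ)) u 0 ∧
          u ≠ 0 ∧ IsClassII (mFourierCoeff u)) ∧
      ∀ (z : ℂ) (u : UnitAddTorus (Fin 3) → EuclideanSpace ℂ (Fin 3)),
        Torus.LinNSResolventRel (1 / (2 * Real.pi * (300 : ℝ))) (Torus.abcFlow 1 1 1) (2 * Real.pi * z) u 0 →
          u ≠ 0 → IsClassII (mFourierCoeff u) → (1 / 5 : ℝ) ≤ z.re → z = lam := by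
  have hs := AbcClassII.sqrt_two_lt
  have hR300 : ((SkewCutBracketReproductions.X0R300.R : ℕ) : ℝ) = 300 := by simp only [SkewCutBracketReproductions.X0R300.R]; norm_num
  -- the X0 coordinate eigenvector
  obtain ⟨lam, hlam, wc, hwc0, hwcr, hwce⟩ :=
    coordinates_of_certificate_of_bases e bf hbf am ham (R := ((SkewCutBracketReproductions.X0R300.R : ℕ) : ℝ)) (by rw [hR300]; norm_num)
      SkewCutBracketReproductions.X0R300.K4 (x₁ := ((SkewCutBracketReproductions.X0R300.x1 : ℚ) : ℝ)) (x₂ := ((SkewCutBracketReproductions.X0R300.x2 : ℚ) : ℝ))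
      (by simp only [SkewCutBracketReproductions.X0R300.x1, SkewCutBracketReproductions.X0R300.x2]; push_cast; norm_num)
      ((SkewCutBracketReproductions.X0R300.mu2lb1_4 : ℚ) : ℝ) ((SkewCutBracketReproductions.X0R300.mu2lb2_4 : ℚ) : ℝ)
      (by simp only [SkewCutBracketReproductions.X0R300.mu2lb1_4]; push_cast; norm_num)
      (by simp only [SkewCutBracketReproductions.X0R300.mu2lb2_4]; push_cast; norm_num)
      (by simp only [SkewCutBracketReproductions.X0R300.R, SkewCutBracketReproductions.X0R300.K4, SkewCutBracketReproductions.X0R300.x1, SkewCutBracketReproductions.X0R300.mu2lb1_4]; push_cast; nlinarith [hs])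
      (by simp only [SkewCutBracketReproductions.X0R300.R, SkewCutBracketReproductions.X0R300.K4, SkewCutBracketReproductions.X0R300.x2, SkewCutBracketReproductions.X0R300.mu2lb2_4]; push_cast; nlinarith [hs])
      hdet hX₁ hX₂
  rw [hR300] at hwce
  -- the classical class-II eigenfunction
  obtain ⟨u₀, hu₀, hu₀0, hu₀II⟩ :=
    classII_eigenfunction_of_coordinates (R := (300 : ℝ)) (by norm_num) (lam : ℂ) wc hwcr hwc0 hwce
  -- the count in classical form, from the INERTIA-3L cell in the bases `e`
  have hcell := fun {n : ℕ} (z : Fin n → ℂ) (hz : Function.Injective z)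
      (u : Fin n → UnitAddTorus (Fin 3) → EuclideanSpace ℂ (Fin 3))
      (hu : ∀ k, Torus.LinNSResolventRel (1 / (2 * Real.pi * (300 : ℝ))) (Torus.abcFlow 1 1 1)
        (2 * Real.pi * z k) (u k) 0)
      (hu0 : ∀ k, u k ≠ 0) (hII : ∀ k, IsClassII (mFourierCoeff (u k))) (hre : ∀ k, (1 / 5 : ℝ) ≤ (z k).re) =>
    card_classII_eigenfunctions_le_of_inertia_certificate_of_bases e bf hbf am ham (R := 300) (a := 1 / 5)
      (rL := 28) (rH := 29) (m := 1) (by norm_num) (by norm_num) (by norm_num) hHL hHH hHB GH' Ah' AHB' ABH' E V'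
      hGH' hAh' hAHB' hABH' hE hR1' hR2' R3_300_29 z hz u hu hu0 hII hre
  -- λ⋆ lies right of a = 1/5
  have hx1 : (1 / 5 : ℝ) < ((SkewCutBracketReproductions.X0R300.x1 : ℚ) : ℝ) := by
    simp only [SkewCutBracketReproductions.X0R300.x1]; push_cast; norm_num
  have hlamre : (1 / 5 : ℝ) ≤ ((lam : ℝ) : ℂ).re := by
    rw [Complex.ofReal_re]; exact hx1.le.trans hlam.1
  refine ⟨lam, hlam, ⟨u₀, hu₀, hu₀0, hu₀II⟩, fun z u hu hu0 huII hzre => ?_⟩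
  exact eq_leader_of_card_le_one (ν := 1 / (2 * Real.pi * (300 : ℝ))) (a := 1 / 5)
    (fun z hz u hu hu0 hII hre => hcell z hz u hu hu0 hII hre) (lam : ℂ) u₀ hu₀ hu₀0 hu₀II hlamre z u hu hu0 huII hzre

include hbf ham in
/-- **R = 300, CLASS II: EXACTLY ONE — IMPLEMENTATION 1's cells.** The X0 row with implementation 1's constants
((T1)(T2) of i3cert j249549: `K3`, `mu2lb1_3`, `mu2lb2_3` of `SkewCutBracketReproductions.X0R300`, as in
`AbcClassIIX0RowsI3Low.X0R300_isLinNSEigenvalue_Ioo_i3`) and the INERTIA-3L cell `(300, II, 1/5, 1; 28, 30)`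
(implementation 1: (R1)(R2) of cert_I3L_R300_cII_a1-5_rL28_rH30.json, j269623), both stated in the bases `e`,
imply: `∃ λ⋆ ∈ [x₁, x₂]` real with a classical CLASS-II eigenfunction, and every classical class-II eigenpair
`(z, u)` with `Re z ≥ 1/5` has `z = λ⋆`. MODEL; conditional on the two certifier audits. -/
theorem R300II_exactly_one_i3
    (hdet : (Matrix.of fun a b : ↥(cubeIdx SkewCutBracketReproductions.X0R300.K3) =>
        (if (a : Idx) = b then ((SkewCutBracketReproductions.X0R300.x1 : ℚ) : ℝ) + onormSq (b : Idx).1 / ((SkewCutBracketReproductions.X0R300.R : ℕ) : ℝ) else 0) - am a b).det *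
      (Matrix.of fun a b : ↥(cubeIdx SkewCutBracketReproductions.X0R300.K3) =>
        (if (a : Idx) = b then ((SkewCutBracketReproductions.X0R300.x2 : ℚ) : ℝ) + onormSq (b : Idx).1 / ((SkewCutBracketReproductions.X0R300.R : ℕ) : ℝ) else 0) - am a b).det < 0)
    (hX₁ : ∀ w : ↥(cubeIdx (SkewCutBracketReproductions.X0R300.K3 + 1) \ cubeIdx SkewCutBracketReproductions.X0R300.K3) → ℝ, ((SkewCutBracketReproductions.X0R300.mu2lb1_3 : ℚ) : ℝ) * (w ⬝ᵥ w) ≤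
      ∑ a : ↥(cubeIdx (SkewCutBracketReproductions.X0R300.K3 + 1) \ cubeIdx SkewCutBracketReproductions.X0R300.K3), (((SkewCutBracketReproductions.X0R300.x1 : ℚ) : ℝ) + onormSq (a : Idx).1 / ((SkewCutBracketReproductions.X0R300.R : ℕ) : ℝ)) * w a ^ 2 -
          Real.sqrt 2 * (w ⬝ᵥ w) -
        w ⬝ᵥ (((Matrix.of fun (a : ↥(cubeIdx (SkewCutBracketReproductions.X0R300.K3 + 1) \ cubeIdx SkewCutBracketReproductions.X0R300.K3)) (b : ↥(cubeIdx SkewCutBracketReproductions.X0R300.K3)) =>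
            (if (a : Idx) = b then ((SkewCutBracketReproductions.X0R300.x1 : ℚ) : ℝ) + onormSq (b : Idx).1 / ((SkewCutBracketReproductions.X0R300.R : ℕ) : ℝ) else 0) - am a b) *
          (Matrix.of fun a b : ↥(cubeIdx SkewCutBracketReproductions.X0R300.K3) =>
            (if (a : Idx) = b then ((SkewCutBracketReproductions.X0R300.x1 : ℚ) : ℝ) + onormSq (b : Idx).1 / ((SkewCutBracketReproductions.X0R300.R : ℕ) : ℝ) else 0) - am a b)⁻¹ *
          (Matrix.of fun (a : ↥(cubeIdx SkewCutBracketReproductions.X0R300.K3)) (b : ↥(cubeIdx (SkewCutBracketReproductions.X0R300.K3 + 1) \ cubeIdx SkewCutBracketReproductions.X0R300.K3)) =>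
            (if (a : Idx) = b then ((SkewCutBracketReproductions.X0R300.x1 : ℚ) : ℝ) + onormSq (b : Idx).1 / ((SkewCutBracketReproductions.X0R300.R : ℕ) : ℝ) else 0) - am a b)) *ᵥ w))
    (hX₂ : ∀ w : ↥(cubeIdx (SkewCutBracketReproductions.X0R300.K3 + 1) \ cubeIdx SkewCutBracketReproductions.X0R300.K3) → ℝ, ((SkewCutBracketReproductions.X0R300.mu2lb2_3 : ℚ) : ℝ) * (w ⬝ᵥ w) ≤
      ∑ a : ↥(cubeIdx (SkewCutBracketReproductions.X0R300.K3 + 1) \ cubeIdx SkewCutBracketReproductions.X0R300.K3), (((SkewCutBracketReproductions.X0R300.x2 : ℚ) : ℝ) + onormSq (a : Idx).1 / ((SkewCutBracketReproductions.X0R300.R : ℕ) : ℝ)) * w a ^ 2 -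
          Real.sqrt 2 * (w ⬝ᵥ w) -
        w ⬝ᵥ (((Matrix.of fun (a : ↥(cubeIdx (SkewCutBracketReproductions.X0R300.K3 + 1) \ cubeIdx SkewCutBracketReproductions.X0R300.K3)) (b : ↥(cubeIdx SkewCutBracketReproductions.X0R300.K3)) =>
            (if (a : Idx) = b then ((SkewCutBracketReproductions.X0R300.x2 : ℚ) : ℝ) + onormSq (b : Idx).1 / ((SkewCutBracketReproductions.X0R300.R : ℕ) : ℝ) else 0) - am a b) *
          (Matrix.of fun a b : ↥(cubeIdx SkewCutBracketReproductions.X0R300.K3) =>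
            (if (a : Idx) = b then ((SkewCutBracketReproductions.X0R300.x2 : ℚ) : ℝ) + onormSq (b : Idx).1 / ((SkewCutBracketReproductions.X0R300.R : ℕ) : ℝ) else 0) - am a b)⁻¹ *
          (Matrix.of fun (a : ↥(cubeIdx SkewCutBracketReproductions.X0R300.K3)) (b : ↥(cubeIdx (SkewCutBracketReproductions.X0R300.K3 + 1) \ cubeIdx SkewCutBracketReproductions.X0R300.K3)) =>
            (if (a : Idx) = b then ((SkewCutBracketReproductions.X0R300.x2 : ℚ) : ℝ) + onormSq (b : Idx).1 / ((SkewCutBracketReproductions.X0R300.R : ℕ) : ℝ) else 0) - am a b)) *ᵥ w))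
    {HL HH HB : Finset Idx}
    (hHL : ∀ i : Idx, i ∈ HL ↔ onormSq i.1 ≤ (28 : ℝ) ^ 2)
    (hHH : ∀ i : Idx, i ∈ HH ↔ onormSq i.1 ≤ (30 : ℝ) ^ 2)
    (hHB : ∀ i : Idx, i ∈ HB ↔ (30 : ℝ) ^ 2 < onormSq i.1 ∧ onormSq i.1 ≤ ((30 : ℝ) + 1) ^ 2)
    (GH' Ah' : Matrix ↥HH ↥HH ℝ) (AHB' : Matrix ↥HH ↥HB ℝ) (ABH' : Matrix ↥HB ↥HH ℝ) (E : ↥HB → ℝ)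
    (V' : Matrix ↥HH (Fin 1) ℝ) (hGH' : GH'ᵀ = GH')
    (hAh' : Ah' = Matrix.of fun i j : ↥HH =>
      (if i = j then -(onormSq i.1.1 / (300 : ℝ)) - (1 / 5 : ℝ) else 0) + am i.1 j.1)
    (hAHB' : AHB' = Matrix.of fun (i : ↥HH) (l : ↥HB) => am i.1 l.1)
    (hABH' : ABH' = Matrix.of fun (l : ↥HB) (i : ↥HH) => am l.1 i.1)
    (hE : E = fun l : ↥HB => onormSq l.1.1 / (300 : ℝ) + (1 / 5 : ℝ) - Real.sqrt 2)
    (hR1' : ∀ x : ↥HH → ℝ, x ≠ 0 →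
      x ⬝ᵥ ((GH' * Ah' + Ah'ᵀ * GH' + (1 / 2 : ℝ) • ((GH' * AHB' + ABH'ᵀ) * Matrix.diagonal (fun l => (E l)⁻¹) *
        (GH' * AHB' + ABH'ᵀ)ᵀ)) *ᵥ x) < 0)
    (hR2' : ∀ x : ↥HH → ℝ, 0 ≤ x ⬝ᵥ ((GH' + V' * V'ᵀ) *ᵥ x)) :
    ∃ lam : ℝ, lam ∈ Set.Icc ((SkewCutBracketReproductions.X0R300.x1 : ℚ) : ℝ) ((SkewCutBracketReproductions.X0R300.x2 : ℚ) : ℝ) ∧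
      (∃ u : UnitAddTorus (Fin 3) → EuclideanSpace ℂ (Fin 3),
        Torus.LinNSResolventRel (1 / (2 * Real.pi * (300 : ℝ))) (Torus.abcFlow 1 1 1) (2 * Real.pi * (lam : ℂ)) u 0 ∧
          u ≠ 0 ∧ IsClassII (mFourierCoeff u)) ∧
      ∀ (z : ℂ) (u : UnitAddTorus (Fin 3) → EuclideanSpace ℂ (Fin 3)),
        Torus.LinNSResolventRel (1 / (2 * Real.pi * (300 : ℝ))) (Torus.abcFlow 1 1 1) (2 * Real.pi * z) u 0 →
          u ≠ 0 → IsClassII (mFourierCoeff u) → (1 / 5 : ℝ) ≤ z.re → z = lam := by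
  have hs := AbcClassII.sqrt_two_lt
  have hR300 : ((SkewCutBracketReproductions.X0R300.R : ℕ) : ℝ) = 300 := by simp only [SkewCutBracketReproductions.X0R300.R]; norm_num
  -- the X0 coordinate eigenvector
  obtain ⟨lam, hlam, wc, hwc0, hwcr, hwce⟩ :=
    coordinates_of_certificate_of_bases e bf hbf am ham (R := ((SkewCutBracketReproductions.X0R300.R : ℕ) : ℝ)) (by rw [hR300]; norm_num)
      SkewCutBracketReproductions.X0R300.K3 (x₁ := ((SkewCutBracketReproductions.X0R300.x1 : ℚ) : ℝ)) (x₂ := ((SkewCutBracketReproductions.X0R300.x2 : ℚ) : ℝ))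
      (by simp only [SkewCutBracketReproductions.X0R300.x1, SkewCutBracketReproductions.X0R300.x2]; push_cast; norm_num)
      ((SkewCutBracketReproductions.X0R300.mu2lb1_3 : ℚ) : ℝ) ((SkewCutBracketReproductions.X0R300.mu2lb2_3 : ℚ) : ℝ)
      (by simp only [SkewCutBracketReproductions.X0R300.mu2lb1_3]; push_cast; norm_num)
      (by simp only [SkewCutBracketReproductions.X0R300.mu2lb2_3]; push_cast; norm_num)
      (by simp only [SkewCutBracketReproductions.X0R300.R, SkewCutBracketReproductions.X0R300.K3, SkewCutBracketReproductions.X0R300.x1, SkewCutBracketReproductions.X0R300.mu2lb1_3]; push_cast; nlinarith [hs])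
      (by simp only [SkewCutBracketReproductions.X0R300.R, SkewCutBracketReproductions.X0R300.K3, SkewCutBracketReproductions.X0R300.x2, SkewCutBracketReproductions.X0R300.mu2lb2_3]; push_cast; nlinarith [hs])
      hdet hX₁ hX₂
  rw [hR300] at hwce
  -- the classical class-II eigenfunction
  obtain ⟨u₀, hu₀, hu₀0, hu₀II⟩ :=
    classII_eigenfunction_of_coordinates (R := (300 : ℝ)) (by norm_num) (lam : ℂ) wc hwcr hwc0 hwce
  -- the count in classical form, from the INERTIA-3L cell in the bases `e`
  have hcell := fun {n : ℕ} (z : Fin n → ℂ) (hz : Function.Injective z)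
      (u : Fin n → UnitAddTorus (Fin 3) → EuclideanSpace ℂ (Fin 3))
      (hu : ∀ k, Torus.LinNSResolventRel (1 / (2 * Real.pi * (300 : ℝ))) (Torus.abcFlow 1 1 1)
        (2 * Real.pi * z k) (u k) 0)
      (hu0 : ∀ k, u k ≠ 0) (hII : ∀ k, IsClassII (mFourierCoeff (u k))) (hre : ∀ k, (1 / 5 : ℝ) ≤ (z k).re) =>
    card_classII_eigenfunctions_le_of_inertia_certificate_of_bases e bf hbf am ham (R := 300) (a := 1 / 5)
      (rL := 28) (rH := 30) (m := 1) (by norm_num) (by norm_num) (by norm_num) hHL hHH hHB GH' Ah' AHB' ABH' E V'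
      hGH' hAh' hAHB' hABH' hE hR1' hR2' R3_300_30 z hz u hu hu0 hII hre
  -- λ⋆ lies right of a = 1/5
  have hx1 : (1 / 5 : ℝ) < ((SkewCutBracketReproductions.X0R300.x1 : ℚ) : ℝ) := by
    simp only [SkewCutBracketReproductions.X0R300.x1]; push_cast; norm_num
  have hlamre : (1 / 5 : ℝ) ≤ ((lam : ℝ) : ℂ).re := by
    rw [Complex.ofReal_re]; exact hx1.le.trans hlam.1
  refine ⟨lam, hlam, ⟨u₀, hu₀, hu₀0, hu₀II⟩, fun z u hu hu0 huII hzre => ?_⟩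
  exact eq_leader_of_card_le_one (ν := 1 / (2 * Real.pi * (300 : ℝ))) (a := 1 / 5)
    (fun z hz u hu hu0 hII hre => hcell z hz u hu hu0 hII hre) (lam : ℂ) u₀ hu₀ hu₀0 hu₀II hlamre z u hu hu0 huII hzre

end ExactlyOne

end Summit.NavierStokesRegularity.FluidComputer.AbcInertia

end
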